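import Summits.CriticalPhenomena.PercolationContinuityZ3.Theorems.Transplant.SkelPhiRootFoot
import HarnessLib

/-!
# N1 (the `{±1}` node), (R) column (N1-R-PLAN v2 §4 (R4d), part b): FOOTPRINT READINGS IN THE SIGNED AND EXCHANGED RUN FRAMES —
# p5-g8's run-box readings are stated for the frame `runX φ c₀ n h 1`; the (R) chain's long run lives in `runX φ c₀ n h σ` (`du` along the cells' axis `0`,
# `σ = sg du`) or `runY φ c₀ n h σ` (`du` along axis `1`).  `runX_neg_mem_Icc` (a box of the reflected frame `σ = −1` is a box of the frame `σ = 1`: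
# `[−hi₀, −lo₀] × [−hi₁ − 1, −lo₁]`, the floor costs one unit), `runY_mem_Icc_iff` (the y′-frame is the x-frame with coordinates exchanged), and the
# footprint boxes `footBox_of_runX_mem_Icc_signed'` (`σ = ±1`) / `footBox_of_runY_mem_Icc` from `footBox_of_runX_mem_Icc`

builds on p205010 (kernel theorem, internal audit signed; external expert review pending) — nothing in this file uses p205010; nothing here is a claim about the open node.
Lane `prim-bschramm`, seat `prim-bschramm-p3` (gen 9; design owner + (R) owner); helper file (`--supports stmt-CriticalPhenomena-4575 --as helper`).
[cite: KozmaNitzan2024, §4 Lemma 12 (pp. 23–25)] [cite: MartineauTassion2017, §4.1, §4.3]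
-/

noncomputable section

namespace Summit.CriticalPhenomena.PercolationContinuityZ3.Theorems

namespace Transplant

namespace Skelφ

open Literature.Probability.Percolation Literature.Probability.LatticeModels SimpleGraph
open Literature.Probability.Percolation.KozmaNitzan.Cells (oth sgOf sgOf_sign)
open TwoAxis.Para (modulus)

variable {V : Type} {φ : V → Site 2}

/-! ## §1 Frame changes -/

/-- Floor of the negation: `⌊s/U⌋ ∈ [−⌊−s/U⌋ − 1, −⌊−s/U⌋]` (`0 < U`). [folklore] -/
theorem ediv_mem_of_neg_ediv {s U : ℤ} (hU : 0 < U) : -((-s) / U) - 1 ≤ s / U ∧ s / U ≤ -((-s) / U) := by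
  have h1 : s % U + U * (s / U) = s := Int.emod_add_mul_ediv s U
  have h2 : (-s) % U + U * ((-s) / U) = -s := Int.emod_add_mul_ediv (-s) U
  have h3 := Int.emod_nonneg s hU.ne'
  have h4 := Int.emod_lt_of_pos s hU
  have h5 := Int.emod_nonneg (-s) hU.ne'
  have h6 := Int.emod_lt_of_pos (-s) hU
  -- `U·(s/U + (−s)/U) = −(s % U) − ((−s) % U) ∈ (−2U, 0]`
  have h7 : U * (s / U + (-s) / U) = -(s % U) - ((-s) % U) := by linarith
  constructor
  · by_contra hc
    push Not at hc
    have : s / U + (-s) / U ≤ -2 := by omega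
    nlinarith
  · by_contra hc
    push Not at hc
    have : 1 ≤ s / U + (-s) / U := by omega
    nlinarith

/-- **A box of the reflected x-frame is a box of the x-frame**: `runX φ c₀ n h (−1) w ∈ [lo, hi]` ⟹ `runX φ c₀ n h 1 w ∈ [(−hi₀, −hi₁ − 1), (−lo₀, −lo₁)]`. [folklore] -/
theorem runX_neg_mem_Icc (c₀ : V) {n : ℕ} (hn : 1 ≤ n) (h : ℤ) {lo hi : Site 2} {w : V} (hw : runX φ c₀ n h (-1) w ∈ Finset.Icc lo hi) :
    runX φ c₀ n h 1 w ∈ Finset.Icc (pt (-hi 0) (-hi 1 - 1)) (pt (-lo 0) (-lo 1)) := by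
  rw [Finset.mem_Icc, Pi.le_def, Pi.le_def] at hw
  have h0l := hw.1 0; have h0u := hw.2 0; have h1l := hw.1 1; have h1u := hw.2 1
  simp only [runX_zero, runX_one, neg_mul, one_mul] at h0l h0u h1l h1u
  have hU := shearUnit_pos hn h
  have hf := ediv_mem_of_neg_ediv (s := shearCoord φ c₀ n h w) hU
  rw [mem_Icc_pt_iff]
  simp only [runX_zero, runX_one, one_mul]
  refine ⟨⟨by linarith, by linarith⟩, by linarith [hf.1], by linarith [hf.2]⟩

/-- **The y′-frame is the x-frame with coordinates exchanged.** [folklore] -/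
theorem runY_mem_Icc_iff (c₀ : V) (n : ℕ) (h σ : ℤ) {lo hi : Site 2} {w : V} :
    runY φ c₀ n h σ w ∈ Finset.Icc lo hi ↔ runX φ c₀ n h σ w ∈ Finset.Icc (pt (lo 1) (lo 0)) (pt (hi 1) (hi 0)) := by
  rw [mem_Icc_pt_iff, Finset.mem_Icc, Pi.le_def, Pi.le_def, Fin.forall_fin_two, Fin.forall_fin_two]
  simp only [runX_zero, runX_one, runY_zero, runY_one]
  tauto

/-! ## §2 Footprint boxes from signed and exchanged run boxes -/

section Read

variable {t₀ : V} {A : ℤ} {n : ℕ} {h vα vβ c₀' c₁' s₀ s₁ D : ℤ}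

/-- **From a box of the reflected x-frame** (`σ = −1`): the readings of the reflected box. [cite: KozmaNitzan2024, §4 Lemma 12 (pp. 23–25)] -/
theorem footBox_of_runX_neg_mem_Icc (t₀ : V) (hA : 0 ≤ A) (hn : 1 ≤ n) (hm : 0 ≤ modulus n h vα vβ) (hc₀ : 0 ≤ c₀') (hc₁ : 0 ≤ c₁') (hD : 0 < D)
    (c₀ : V) {lo hi LO HI : Site 2}
    (hLO0 : LO 0 ≤ fineSkel φ t₀ A n h vα vβ c₀' c₁' s₀ s₁ D c₀ 0 +
      (c₀' * (A * (modulus n h vα vβ * (-hi 0) -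
        max (vα * ((shearUnit n h : ℤ) * (-hi 1 - 1))) (vα * ((shearUnit n h : ℤ) * (-lo 1) + shearUnit n h - 1))) / n)) / D)
    (hHI0 : fineSkel φ t₀ A n h vα vβ c₀' c₁' s₀ s₁ D c₀ 0 +
      (c₀' * (A * (modulus n h vα vβ * (-lo 0) -
        min (vα * ((shearUnit n h : ℤ) * (-hi 1 - 1))) (vα * ((shearUnit n h : ℤ) * (-lo 1) + shearUnit n h - 1))) / n)) / D + 1 ≤ HI 0)
    (hLO1 : LO 1 ≤ fineSkel φ t₀ A n h vα vβ c₀' c₁' s₀ s₁ D c₀ 1 + (c₁' * (A * ((shearUnit n h : ℤ) * (-hi 1 - 1)))) / D)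
    (hHI1 : fineSkel φ t₀ A n h vα vβ c₀' c₁' s₀ s₁ D c₀ 1 + (c₁' * (A * ((shearUnit n h : ℤ) * (-lo 1) + shearUnit n h - 1))) / D + 1 ≤ HI 1)
    {lopar hipar wperp : ℤ} {du : MDir}
    (h₁ : sgOf du = 1 → lopar ≤ LO du.1 ∧ HI du.1 ≤ hipar) (h₂ : sgOf du = -1 → lopar ≤ -HI du.1 ∧ -LO du.1 ≤ hipar)
    (h₃ : -wperp ≤ LO (oth du.1) ∧ HI (oth du.1) ≤ wperp)
    {v : V} (hv : runX φ c₀ n h (-1) v ∈ Finset.Icc lo hi) :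
    FootBox lopar hipar wperp du (fineSkel φ t₀ A n h vα vβ c₀' c₁' s₀ s₁ D v) := by
  have hv' := runX_neg_mem_Icc c₀ hn h hv
  refine footBox_of_runX_mem_Icc t₀ hA hn hm hc₀ hc₁ hD c₀ (lo := pt (-hi 0) (-hi 1 - 1)) (hi := pt (-lo 0) (-lo 1)) ?_ ?_ ?_ ?_ h₁ h₂ h₃ hv'
  · simpa only [pt_zero, pt_one] using hLO0
  · simpa only [pt_zero, pt_one] using hHI0
  · simpa only [pt_zero, pt_one] using hLO1
  · simpa only [pt_zero, pt_one] using hHI1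

/-- **From a box of the y′-frame** `runY φ c₀ n h 1`: the readings of the exchanged box. [cite: KozmaNitzan2024, §4 Lemma 12 (pp. 23–25)] -/
theorem footBox_of_runY_mem_Icc (t₀ : V) (hA : 0 ≤ A) (hn : 1 ≤ n) (hm : 0 ≤ modulus n h vα vβ) (hc₀ : 0 ≤ c₀') (hc₁ : 0 ≤ c₁') (hD : 0 < D)
    (c₀ : V) {lo hi LO HI : Site 2}
    (hLO0 : LO 0 ≤ fineSkel φ t₀ A n h vα vβ c₀' c₁' s₀ s₁ D c₀ 0 +
      (c₀' * (A * (modulus n h vα vβ * lo 1 - max (vα * ((shearUnit n h : ℤ) * lo 0)) (vα * ((shearUnit n h : ℤ) * hi 0 + shearUnit n h - 1))) / n)) / D)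
    (hHI0 : fineSkel φ t₀ A n h vα vβ c₀' c₁' s₀ s₁ D c₀ 0 +
      (c₀' * (A * (modulus n h vα vβ * hi 1 - min (vα * ((shearUnit n h : ℤ) * lo 0)) (vα * ((shearUnit n h : ℤ) * hi 0 + shearUnit n h - 1))) / n)) / D
        + 1 ≤ HI 0)
    (hLO1 : LO 1 ≤ fineSkel φ t₀ A n h vα vβ c₀' c₁' s₀ s₁ D c₀ 1 + (c₁' * (A * ((shearUnit n h : ℤ) * lo 0))) / D)
    (hHI1 : fineSkel φ t₀ A n h vα vβ c₀' c₁' s₀ s₁ D c₀ 1 + (c₁' * (A * ((shearUnit n h : ℤ) * hi 0 + shearUnit n h - 1))) / D + 1 ≤ HI 1)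
    {lopar hipar wperp : ℤ} {du : MDir}
    (h₁ : sgOf du = 1 → lopar ≤ LO du.1 ∧ HI du.1 ≤ hipar) (h₂ : sgOf du = -1 → lopar ≤ -HI du.1 ∧ -LO du.1 ≤ hipar)
    (h₃ : -wperp ≤ LO (oth du.1) ∧ HI (oth du.1) ≤ wperp)
    {v : V} (hv : runY φ c₀ n h 1 v ∈ Finset.Icc lo hi) :
    FootBox lopar hipar wperp du (fineSkel φ t₀ A n h vα vβ c₀' c₁' s₀ s₁ D v) := by
  have hv' := (runY_mem_Icc_iff c₀ n h 1).1 hv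
  refine footBox_of_runX_mem_Icc t₀ hA hn hm hc₀ hc₁ hD c₀ (lo := pt (lo 1) (lo 0)) (hi := pt (hi 1) (hi 0)) ?_ ?_ ?_ ?_ h₁ h₂ h₃ hv'
  · simpa only [pt_zero, pt_one] using hLO0
  · simpa only [pt_zero, pt_one] using hHI0
  · simpa only [pt_zero, pt_one] using hLO1
  · simpa only [pt_zero, pt_one] using hHI1

/-- **From a box of the reflected y′-frame** `runY φ c₀ n h (−1)`: exchange, then reflect. [cite: KozmaNitzan2024, §4 Lemma 12 (pp. 23–25)] -/
theorem footBox_of_runY_neg_mem_Icc (t₀ : V) (hA : 0 ≤ A) (hn : 1 ≤ n) (hm : 0 ≤ modulus n h vα vβ) (hc₀ : 0 ≤ c₀') (hc₁ : 0 ≤ c₁') (hD : 0 < D)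
    (c₀ : V) {lo hi LO HI : Site 2}
    (hLO0 : LO 0 ≤ fineSkel φ t₀ A n h vα vβ c₀' c₁' s₀ s₁ D c₀ 0 +
      (c₀' * (A * (modulus n h vα vβ * (-hi 1) -
        max (vα * ((shearUnit n h : ℤ) * (-hi 0 - 1))) (vα * ((shearUnit n h : ℤ) * (-lo 0) + shearUnit n h - 1))) / n)) / D)
    (hHI0 : fineSkel φ t₀ A n h vα vβ c₀' c₁' s₀ s₁ D c₀ 0 +
      (c₀' * (A * (modulus n h vα vβ * (-lo 1) -
        min (vα * ((shearUnit n h : ℤ) * (-hi 0 - 1))) (vα * ((shearUnit n h : ℤ) * (-lo 0) + shearUnit n h - 1))) / n)) / D + 1 ≤ HI 0)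
    (hLO1 : LO 1 ≤ fineSkel φ t₀ A n h vα vβ c₀' c₁' s₀ s₁ D c₀ 1 + (c₁' * (A * ((shearUnit n h : ℤ) * (-hi 0 - 1)))) / D)
    (hHI1 : fineSkel φ t₀ A n h vα vβ c₀' c₁' s₀ s₁ D c₀ 1 + (c₁' * (A * ((shearUnit n h : ℤ) * (-lo 0) + shearUnit n h - 1))) / D + 1 ≤ HI 1)
    {lopar hipar wperp : ℤ} {du : MDir}
    (h₁ : sgOf du = 1 → lopar ≤ LO du.1 ∧ HI du.1 ≤ hipar) (h₂ : sgOf du = -1 → lopar ≤ -HI du.1 ∧ -LO du.1 ≤ hipar)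
    (h₃ : -wperp ≤ LO (oth du.1) ∧ HI (oth du.1) ≤ wperp)
    {v : V} (hv : runY φ c₀ n h (-1) v ∈ Finset.Icc lo hi) :
    FootBox lopar hipar wperp du (fineSkel φ t₀ A n h vα vβ c₀' c₁' s₀ s₁ D v) := by
  have hv' := runX_neg_mem_Icc c₀ hn h ((runY_mem_Icc_iff c₀ n h (-1)).1 hv)
  simp only [pt_zero, pt_one] at hv'
  refine footBox_of_runX_mem_Icc t₀ hA hn hm hc₀ hc₁ hD c₀ (lo := pt (-hi 1) (-hi 0 - 1)) (hi := pt (-lo 1) (-lo 0)) ?_ ?_ ?_ ?_ h₁ h₂ h₃ hv'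
  · simpa only [pt_zero, pt_one] using hLO0
  · simpa only [pt_zero, pt_one] using hHI0
  · simpa only [pt_zero, pt_one] using hLO1
  · simpa only [pt_zero, pt_one] using hHI1

end Read

end Skelφ

end Transplant

end Summit.CriticalPhenomena.PercolationContinuityZ3.Theorems

end
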